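import Summits.CriticalPhenomena.CardyFormulaZ2.Theorems.CardySelfDualSegmentUniformMarginalityStubFixedDomainContinuityOne
import Summits.CriticalPhenomena.CardyFormulaZ2.Theorems.CardySelfDualSegmentUniformMarginalityPointwiseBoxCrossing
import Summits.CriticalPhenomena.CardyFormulaZ2.Theses.CardySegmentWeakRSW

/-!
# Alternative line `box-crossing-conditional` for the crux `UniformMarginality` (stmt-CriticalPhenomena-5472)
(crux-strategist cstrat-stmt-CriticalPhenomena-5472-s3, 2026-08-17; the live line `Lines/Sketch.lean` v10.3 is untouched)

THE CUT.  The live line holds the crux's kernel as ONE unconditional stub (B₁) = UM_rect whose only known proof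
needs two research inputs at once — t-UNIFORM Russo–Seymour–Welsh bounds for the corner family `M_t` (= the
sibling crux `UniformBoxCrossing`, stmt-CriticalPhenomena-5476, itself open) AND the sharp spare-arm domination SAD —
and a second unconditional stub (B₂ᵒ) whose only known proof needs POINTWISE RSW for `M_{t₀}` (Bollobás–Riordan
Conj. 8.2 class) plus a port of the tree's Schramm–Smirnov (5.1) chain.  Twelve lead cycles report "no
worker-provable stub ⇒ wave: none": the RSW blockage sits in front of both stubs.  This line moves the blockage
into ONE stub that is LITERALLY the sibling item (so it is staffed once, by 5476's own seats, and closes when 5476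
closes) and exposes the two conditional kernels as stubs a worker can attack today:

* `stub_uniformBoxCrossing` : `CardySelfDualSegment.UniformBoxCrossing` — by NAME = stmt-CriticalPhenomena-5476
  (shared dependency, not new content; necessary anyway: UM ∧ pointwise box crossing ⟹ UBC is the tree theorem
  `uniformBoxCrossing_of_uniformMarginality_of_pointwise`, p157143).
* `stub_marginalityRect_of_uniformBoxCrossing` : UBC → (B₁) — THE RESEARCH KERNEL PROPER: quantitative marginality
  on rectilinear conformal rectangles GIVEN the full t-uniform RSW toolbox (quasi-multiplicativity, arm separation,
  a-priori 5-arm / half-plane 3-arm exponent 2, all derivable from UBC uniformly in t).  Intended proof: the landed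
  exact mirror census `deriv_Pext_eq_mirrorCensus_verts` (p143330) + termwise spare-arm domination SAD + summability
  of the majorants, through the landed `integratedBoundAt_of_mirrorDomination` and
  `uniformMarginalityRect_iff_integratedBoundRectilinear` (p137344).  Strictly weaker than (B₁) as typed
  ((B₁) ⟹ it trivially; the converse needs UBC, open and "the one item that may be false").
* `stub_discreteContinuity_of_boxCrossing` : for `0 < t₀ < 1`, the box-crossing property of the SINGLE model
  `M_{t₀}` ⟹ Schramm–Smirnov's discrete continuity estimate (5.1) for `M_{t₀}` at every quad of the plane — the
  measure-generic port of `QuadCrossingContinuity*` (Lemma 6.1's one primal chart-move bound re-run with a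
  corner-wise exploration; FKG for t ≤ 1, 1-dependence), size L, NO research input beyond its hypothesis.

Composition: `hasBoxCrossingProperty_of_uniformBoxCrossing` (p157143 file) turns stub 1 into pointwise box
crossing; stubs 2, 3 then feed the landed v10 reduction `uniformMarginality_of_rectilinear_of_discreteInterior`
exactly as in line `Sketch`; `UniformMarginality_of` concludes `CardySelfDualSegment.UniformMarginality` BY NAME and
`UniformMarginality_of'` the rfl-equal decl of route `CardySegmentWeakRSW`.

Disproof.lean (rev 3) has no `_false_without_` theorem and no `-- Targets` section; negatives honoured: no stub
quantifies `∃ η ∀ R` (`not_uniformInR`), mesh-uniformity is kept (`withoutMeshUniformity_holds` is the trivial side).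
-/

noncomputable section

namespace Summit.CriticalPhenomena.CardyFormulaZ2.Cruxes.UniformMarginality.BoxCrossingConditional

open scoped ENNReal
open Literature.Probability.Percolation Literature.Probability.LatticeModels
  Literature.Probability.RandomPlanarGeometry
open Literature.Probability.Percolation.QuadCrossing (Quad)
open Literature.Probability.Percolation.QuadCrossing.Quad (StrictlyDominated)
open Summit.CriticalPhenomena.CardyFormulaZ2.Cruxes.UniformMarginality.HeatFlow
open Summit.CriticalPhenomena.CardyFormulaZ2.Theses.CardySelfDualSegment (UniformBoxCrossing)

/-- STUB 1 (shared dependency): **t-uniform box-crossing bounds for the corner family** — literally the sibling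
crux `UniformBoxCrossing` (stmt-CriticalPhenomena-5476), by name.  Closes when 5476 closes. -/
theorem stub_uniformBoxCrossing : UniformBoxCrossing := by
  sorry

/-- STUB 2 (research kernel): **quantitative marginality on rectilinear conformal rectangles GIVEN t-uniform
RSW** — under `UniformBoxCrossing`, for `R` whose boundary is covered by finitely many axis-parallel segments the
map `t ↦ P_t(R,δ)` has at every `t₀ ∈ [0,1]` a modulus of continuity uniform in the mesh.  (Mirror census p143330
+ spare-arm domination SAD + summable majorants via `integratedBoundAt_of_mirrorDomination`.) -/
theorem stub_marginalityRect_of_uniformBoxCrossing :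
    UniformBoxCrossing →
      ∀ R : ConformalRectangle,
        (∃ S : Finset (ℂ × ℂ), (∀ p ∈ S, p.1.re = p.2.re ∨ p.1.im = p.2.im) ∧
          frontier R.carrier ⊆ ⋃ p ∈ S, segment ℝ p.1 p.2) →
        ∀ t₀ : ℝ, t₀ ∈ Set.Icc (0 : ℝ) 1 → ∀ ε > 0, ∃ η > 0,
          ∀ δ : ℝ, 0 < δ → ∀ t ∈ Set.Icc (0 : ℝ) 1, |t - t₀| < η → |Pext R δ t - Pext R δ t₀| < ε := by
  sorry

/-- STUB 3 (port, size L): **Schramm–Smirnov (5.1) for the single corner model `M_{t₀}`, `0 < t₀ < 1`, GIVEN its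
box-crossing property** — for every quad `Q₀` of the plane and `ε > 0` there are quads `Q' < Q₀ < Q''` and `δ₀ > 0`
with `M_{t₀}[Q' crossed inside the open edges of δℤ² ∧ Q'' not crossed] ≤ ε` for `0 < δ < δ₀`. -/
theorem stub_discreteContinuity_of_boxCrossing :
    ∀ t₀ : unitInterval, 0 < (t₀ : ℝ) → (t₀ : ℝ) < 1 →
      HasBoxCrossingProperty (cornerPercolation t₀) squareLatticeEmbedding.z →
      ∀ (Q₀ : Quad (Set.univ : Set ℂ)) (ε : ℝ≥0∞), 0 < ε →
        ∃ Q' Q'' : Quad (Set.univ : Set ℂ), StrictlyDominated Q' Q₀ ∧ StrictlyDominated Q₀ Q'' ∧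
          ∃ δ₀ : ℝ, 0 < δ₀ ∧ ∀ δ : ℝ, 0 < δ → δ < δ₀ →
            cornerPercolation t₀ {ω | (∃ K, Q'.IsCrossing K ∧ K ⊆ openEdgeUnion δ ω) ∧
                ¬ ∃ K, Q''.IsCrossing K ∧ K ⊆ openEdgeUnion δ ω} ≤ ε := by
  sorry

/-- **Composition = the skeleton (kernel-checked, no sorry): the three stubs give the crux**
`CardySelfDualSegment.UniformMarginality` BY NAME, through `hasBoxCrossingProperty_of_uniformBoxCrossing` (stub 1 ⟹ pointwise
box crossing) and the landed v10 reduction `uniformMarginality_of_rectilinear_of_discreteInterior` (exactly as in line `Sketch`). -/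
theorem UniformMarginality_of :
    Summit.CriticalPhenomena.CardyFormulaZ2.Theses.CardySelfDualSegment.UniformMarginality :=
  uniformMarginality_of_rectilinear_of_discreteInterior
    (stub_marginalityRect_of_uniformBoxCrossing stub_uniformBoxCrossing)
    (fun t₀ h0 h1 => stub_discreteContinuity_of_boxCrossing t₀ h0 h1
      (hasBoxCrossingProperty_of_uniformBoxCrossing stub_uniformBoxCrossing t₀))

/-- **The line closes the crux** (route `CardySegmentWeakRSW`'s decl, BY NAME — the two route decls are the same
term). -/
theorem UniformMarginality_of' :
    Summit.CriticalPhenomena.CardyFormulaZ2.Theses.CardySegmentWeakRSW.UniformMarginality :=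
  UniformMarginality_of

end Summit.CriticalPhenomena.CardyFormulaZ2.Cruxes.UniformMarginality.BoxCrossingConditional

end
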